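import Summits.HodgeConjecture.HodgeCM.Model.Toy.Duality_1

/-! PORT of `HodgeCM/Model/Toy/Duality.lean` (HodgeCMPerL run 82) — part 2: continuation of `Summits.HodgeConjecture.HodgeCM.Model.Toy.Duality_1` (split at a top-level declaration boundary by port_pkg.py; scope re-opened below; declarations unchanged). -/

-- port_pkg: scope re-opened for this part (file-level context, then the namespace/section stack open at the cut)
noncomputable section
namespace HodgeCM.Toy
open Literature.AlgebraicGeometry.Motives
open Literature.AlgebraicGeometry.Motives.HodgeStructure (EndAction conj ofRat ofRat_apply complexConj
  mem_hodgeClasses_iff)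
open Literature.AlgebraicGeometry.ShimuraVarieties (conjRingHomK embedding_conjRingHomK)
open scoped TensorProduct
open exteriorPower CMPresentation Module
variable (K : CMField) (Φ : Fin 4 → CMType K)
section Swap
variable {R : Type*} [Field R] {V : Type*} [AddCommGroup V] [Module R V]
/-- **Swap**: the contracted sum only depends on the Casimir tensor `Σ u ⊗ u'`. -/
theorem T4_eq_of_casimir {ι κ : Type*} [Fintype ι] [Fintype κ] {k : ℕ}
    (vol : ⋀[R]^(k+1+1+1+1) V →ₗ[R] R) {u u' : ι → V} {v v' : κ → V}
    (h : ∑ i, u i ⊗ₜ[R] u' i = ∑ s, v s ⊗ₜ[R] v' s) (z : ⋀[R]^k V) :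
    T4 vol u u' z = T4 vol v v' z := by
  unfold T4
  -- slot 0 (outermost sum)
  rw [casimir_swap₂ h
    (∑ b, ∑ c, ∑ d, r1
      (vol ∘ₗ (wedge R V (k+1+1+1) 1).flip (ι1 R V (u d)) ∘ₗ (wedge R V (k+1+1) 1).flip (ι1 R V (u c))
        ∘ₗ (wedge R V (k+1) 1).flip (ι1 R V (u b)) ∘ₗ wedge R V k 1 z ∘ₗ ι1 R V)
      ((wedge R V (1+1+1) 1).flip (ι1 R V (u' d)) ∘ₗ (wedge R V (1+1) 1).flip (ι1 R V (u' c))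
        ∘ₗ (wedge R V 1 1).flip (ι1 R V (u' b)) ∘ₗ ι1 R V))
    (fun x y => ∑ b, ∑ c, ∑ d, vol (W4 z x (u b) (u c) (u d)) • W4' y (u' b) (u' c) (u' d))
    (fun x y => by simp only [LinearMap.sum_apply]; rfl)]
  refine Finset.sum_congr rfl fun t₀ _ => ?_
  -- slot 1
  rw [casimir_swap₂ h
    (∑ c, ∑ d, r1
      (vol ∘ₗ (wedge R V (k+1+1+1) 1).flip (ι1 R V (u d)) ∘ₗ (wedge R V (k+1+1) 1).flip (ι1 R V (u c))
        ∘ₗ wedge R V (k+1) 1 (wedge R V k 1 z (ι1 R V (v t₀))) ∘ₗ ι1 R V)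
      ((wedge R V (1+1+1) 1).flip (ι1 R V (u' d)) ∘ₗ (wedge R V (1+1) 1).flip (ι1 R V (u' c))
        ∘ₗ wedge R V 1 1 (ι1 R V (v' t₀)) ∘ₗ ι1 R V))
    (fun x y => ∑ c, ∑ d, vol (W4 z (v t₀) x (u c) (u d)) • W4' (v' t₀) y (u' c) (u' d))
    (fun x y => by simp only [LinearMap.sum_apply]; rfl)]
  refine Finset.sum_congr rfl fun t₁ _ => ?_
  -- slot 2
  rw [casimir_swap₂ h
    (∑ d, r1
      (vol ∘ₗ (wedge R V (k+1+1+1) 1).flip (ι1 R V (u d))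
        ∘ₗ wedge R V (k+1+1) 1 (wedge R V (k+1) 1 (wedge R V k 1 z (ι1 R V (v t₀))) (ι1 R V (v t₁))) ∘ₗ ι1 R V)
      ((wedge R V (1+1+1) 1).flip (ι1 R V (u' d))
        ∘ₗ wedge R V (1+1) 1 (wedge R V 1 1 (ι1 R V (v' t₀)) (ι1 R V (v' t₁))) ∘ₗ ι1 R V))
    (fun x y => ∑ d, vol (W4 z (v t₀) (v t₁) x (u d)) • W4' (v' t₀) (v' t₁) y (u' d))
    (fun x y => by simp only [LinearMap.sum_apply]; rfl)]
  refine Finset.sum_congr rfl fun t₂ _ => ?_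
  -- slot 3
  exact casimir_swap₂ h
    (r1 (vol ∘ₗ wedge R V (k+1+1+1) 1 (wedge R V (k+1+1) 1 (wedge R V (k+1) 1
        (wedge R V k 1 z (ι1 R V (v t₀))) (ι1 R V (v t₁))) (ι1 R V (v t₂))) ∘ₗ ι1 R V)
      (wedge R V (1+1+1) 1 (wedge R V (1+1) 1 (wedge R V 1 1 (ι1 R V (v' t₀)) (ι1 R V (v' t₁)))
        (ι1 R V (v' t₂))) ∘ₗ ι1 R V))
    (fun x y => vol (W4 z (v t₀) (v t₁) (v t₂) x) • W4' (v' t₀) (v' t₁) (v' t₂) y)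
    (fun x y => rfl)

/-- (Ported verbatim from the HodgeCMPerL package; no docstring in the source.) -/
lemma map_sum₄ {ι M N : Type*} [Fintype ι] [AddCommGroup M] [Module R M] [AddCommGroup N]
    [Module R N] (f : M →ₗ[R] N) (t : ι → ι → ι → ι → M) :
    f (∑ a, ∑ b, ∑ c, ∑ d, t a b c d) = ∑ a, ∑ b, ∑ c, ∑ d, f (t a b c d) := by
  simp only [map_sum]

omit [Field R] in
/-- (Ported verbatim from the HodgeCMPerL package; no docstring in the source.) -/
lemma smul_sum₄ {S ι M : Type*} [Fintype ι] [AddCommGroup M] [Monoid S] [DistribMulAction S M] (r : S)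
    (t : ι → ι → ι → ι → M) :
    r • (∑ a, ∑ b, ∑ c, ∑ d, t a b c d) = ∑ a, ∑ b, ∑ c, ∑ d, r • t a b c d := by
  simp only [Finset.smul_sum]

/-- (Ported verbatim from the HodgeCMPerL package; no docstring in the source.) -/
lemma rat_smul_eq {M : Type*} [AddCommGroup M] [Module ℂ M] [Module ℚ M] [IsScalarTower ℚ ℂ M]
    (q : ℚ) (x : M) : q • x = (q : ℂ) • x := by
  rw [← Rat.smul_one_eq_cast, smul_assoc, one_smul]

end Swap


/-! ## Part S3: the Casimir tensor of `P = A_{Φ₀} × ⋯ × A_{Φ₃}` -/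

section PCasimir

variable (K : CMField) (Φ : Fin 4 → CMType K)

/-- the rational index: a slot and a basis index of its atom field -/
abbrev RIdx (X : Obj) := Σ i : X.s.toType, Fin (Module.finrank ℚ (X.atom i).F)

/-- complex conjugation on the atoms of `P` -/
def cP : (i : (PP K Φ).s.toType) → (((PP K Φ).atom i).F →+* ((PP K Φ).atom i).F)
  | Sum.inl (Sum.inl (Sum.inl _)) => cF K
  | Sum.inl (Sum.inl (Sum.inr _)) => cF K
  | Sum.inl (Sum.inr _) => cF K
  | Sum.inr _ => cF K

/-- (Ported verbatim from the HodgeCMPerL package; no docstring in the source.) -/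
lemma emb_cP (i : (PP K Φ).s.toType) (τ : ((PP K Φ).atom i).F →+* ℂ) (x : ((PP K Φ).atom i).F) :
    τ (cP K Φ i x) = starRingEnd ℂ (τ x) := by
  rcases i with ((i | i) | i) | i <;> cases i <;> exact emb_cF K τ x

/-- the rational trace basis of `H¹(P, ℚ)` … -/
def bv (j : RIdx (PP K Φ)) : (PP K Φ).L := Pi.single j.1 (bF _ j.2)

/-- … and its conjugate trace-dual basis -/
def bv' (j : RIdx (PP K Φ)) : (PP K Φ).L := Pi.single j.1 (cP K Φ j.1 (dF _ j.2))

/-- **The Casimir tensor of `P`**: `Σ_j (1 ⊗ b_j) ⊗ (1 ⊗ b'_j) = Σ_s e_s ⊗ e_{s̄}`. -/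
theorem P_casimir :
    ∑ j : RIdx (PP K Φ), ((1 : ℂ) ⊗ₜ[ℚ] bv K Φ j) ⊗ₜ[ℂ] ((1 : ℂ) ⊗ₜ[ℚ] bv' K Φ j)
      = ∑ s : (PP K Φ).Idx, (PP K Φ).eB s ⊗ₜ[ℂ] (PP K Φ).eB ((PP K Φ).bar s) := by
  rw [Fintype.sum_sigma, Fintype.sum_sigma]
  refine Finset.sum_congr rfl fun i _ => ?_
  have hu : ∀ x : ((PP K Φ).atom i).F, (1 : ℂ) ⊗ₜ[ℚ] (Pi.single i x : (PP K Φ).L)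
      = (LinearMap.single ℚ (fun j => (((PP K Φ).atom j).F : Type)) i).baseChange ℂ
          ((1 : ℂ) ⊗ₜ[ℚ] x) := fun x => by
    rw [LinearMap.baseChange_tmul]; rfl
  have h := congrArg (TensorProduct.map
    ((LinearMap.single ℚ (fun j => (((PP K Φ).atom j).F : Type)) i).baseChange ℂ)
    ((LinearMap.single ℚ (fun j => (((PP K Φ).atom j).F : Type)) i).baseChange ℂ))
    (atom_casimir (cP K Φ i) (emb_cP K Φ i))
  simp only [map_sum, TensorProduct.map_tmul] at h
  simp only [bv, bv', hu]
  rw [h]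
  refine Finset.sum_congr rfl fun τ _ => ?_
  rw [Obj.eB_apply', Obj.eB_apply']
  rfl

end PCasimir


/-! ## Part S4: base change of the wedge gadgets -/

section ThetaW

variable (X : Obj)

/-- (Ported verbatim from the HodgeCMPerL package; no docstring in the source.) -/
lemma ofRat_injective {V : Type*} [AddCommGroup V] [Module ℚ V] :
    Function.Injective (fun v : V => (1 : ℂ) ⊗ₜ[ℚ] v) := by
  have h := (Module.Flat.rTensor_preserves_injective_linearMap (M := V) (Algebra.linearMap ℚ ℂ)
    (algebraMap ℚ ℂ).injective).comp (TensorProduct.lid ℚ V).symm.injective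
  convert h using 1
  ext v
  simp

/-- (Ported verbatim from the HodgeCMPerL package; no docstring in the source.) -/
lemma theta_ι1 (x : X.L) :
    X.Θ 1 ((1 : ℂ) ⊗ₜ[ℚ] ι1 ℚ X.L x) = ι1 ℂ X.LC ((1 : ℂ) ⊗ₜ[ℚ] x) := by
  have h := BC.theta_one_baseChange_oneEquiv_symm ℚ ℂ X.L ((1 : ℂ) ⊗ₜ[ℚ] x)
  rw [LinearMap.baseChange_tmul] at h
  exact h

/-- (Ported verbatim from the HodgeCMPerL package; no docstring in the source.) -/
lemma theta_wedge_ι1 (n : ℕ) (y : ⋀[ℚ]^n X.L) (x : X.L) :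
    X.Θ (n+1) ((1 : ℂ) ⊗ₜ[ℚ] wedge ℚ X.L n 1 y (ι1 ℚ X.L x))
      = wedge ℂ X.LC n 1 (X.Θ n ((1 : ℂ) ⊗ₜ[ℚ] y)) (ι1 ℂ X.LC ((1 : ℂ) ⊗ₜ[ℚ] x)) := by
  apply Subtype.ext
  rw [BC.thetaEquiv_apply, BC.theta_tmul, one_smul, BC.thetaLin_wedge, wedge_coe,
    BC.thetaEquiv_apply, BC.theta_tmul, one_smul]
  congr 1
  have h := theta_ι1 X x
  rw [BC.thetaEquiv_apply, BC.theta_tmul, one_smul] at h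
  exact congrArg Subtype.val h

/-- (Ported verbatim from the HodgeCMPerL package; no docstring in the source.) -/
lemma theta_W4 {n : ℕ} (y : ⋀[ℚ]^n X.L) (x₀ x₁ x₂ x₃ : X.L) :
    X.Θ (n+1+1+1+1) ((1 : ℂ) ⊗ₜ[ℚ] W4 y x₀ x₁ x₂ x₃)
      = W4 (X.Θ n ((1 : ℂ) ⊗ₜ[ℚ] y)) ((1 : ℂ) ⊗ₜ[ℚ] x₀) ((1 : ℂ) ⊗ₜ[ℚ] x₁)
          ((1 : ℂ) ⊗ₜ[ℚ] x₂) ((1 : ℂ) ⊗ₜ[ℚ] x₃) := by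
  rw [theta_wedge_ι1, theta_wedge_ι1, theta_wedge_ι1, theta_wedge_ι1]

/-- (Ported verbatim from the HodgeCMPerL package; no docstring in the source.) -/
lemma theta_W4' (x₀ x₁ x₂ x₃ : X.L) :
    X.Θ (1+1+1+1) ((1 : ℂ) ⊗ₜ[ℚ] W4' x₀ x₁ x₂ x₃)
      = W4' ((1 : ℂ) ⊗ₜ[ℚ] x₀) ((1 : ℂ) ⊗ₜ[ℚ] x₁) ((1 : ℂ) ⊗ₜ[ℚ] x₂) ((1 : ℂ) ⊗ₜ[ℚ] x₃) := by
  rw [theta_wedge_ι1, theta_wedge_ι1, theta_wedge_ι1, theta_ι1]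

end ThetaW

/-! ## Part S5: the rational star operator and its complexification -/

section Star

variable (K : CMField) (Φ : Fin 4 → CMType K)

/-- the complexified trace bases -/
def bC (j : RIdx (PP K Φ)) : (PP K Φ).LC := (1 : ℂ) ⊗ₜ[ℚ] bv K Φ j
/-- (Ported verbatim from the HodgeCMPerL package; no docstring in the source.) -/
def bC' (j : RIdx (PP K Φ)) : (PP K Φ).LC := (1 : ℂ) ⊗ₜ[ℚ] bv' K Φ j

variable (k : ℕ) (hk : Module.finrank ℚ (PP K Φ).L = k+1+1+1+1)

include hk

/-- (Ported verbatim from the HodgeCMPerL package; no docstring in the source.) -/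
lemma finrank_top : Module.finrank ℚ (⋀[ℚ]^(k+1+1+1+1) (PP K Φ).L) = 1 := by
  rw [exteriorPower.finrank_eq, hk, Nat.choose_self]

/-- a basis of the (one-dimensional) top exterior power -/
def topB : Module.Basis (Fin 1) ℚ (⋀[ℚ]^(k+1+1+1+1) (PP K Φ).L) :=
  Module.finBasisOfFinrankEq ℚ _ (finrank_top K Φ k hk)

/-- the rational volume form -/
def lam : ⋀[ℚ]^(k+1+1+1+1) (PP K Φ).L →ₗ[ℚ] ℚ := (topB K Φ k hk).coord 0

/-- (Ported verbatim from the HodgeCMPerL package; no docstring in the source.) -/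
lemma eq_lam_smul (x : ⋀[ℚ]^(k+1+1+1+1) (PP K Φ).L) :
    x = lam K Φ k hk x • topB K Φ k hk 0 := by
  have h := (topB K Φ k hk).sum_repr x
  rw [Fin.sum_univ_one] at h
  exact h.symm

/-- **the rational operator** `D : ⋀^k H¹(P,ℚ) → ⋀⁴ H¹(P,ℚ)` -/
def DQ : ⋀[ℚ]^k (PP K Φ).L →ₗ[ℚ] ⋀[ℚ]^(1+1+1+1) (PP K Φ).L :=
  T4L (lam K Φ k hk) (bv K Φ) (bv' K Φ)

/-- (Ported verbatim from the HodgeCMPerL package; no docstring in the source.) -/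
lemma card_Idx_eq : Fintype.card (PP K Φ).Idx = k+1+1+1+1 := by
  rw [card_idx_PP, ← finrank_L_PP, hk]

/-- the top index of the complex wedge basis -/
def topI : Set.powersetCard (PP K Φ).Idx (k+1+1+1+1) :=
  ⟨Finset.univ, by
    show (Finset.univ : Finset (PP K Φ).Idx).card = k+1+1+1+1
    rw [Finset.card_univ, card_Idx_eq K Φ k hk]⟩

/-- (Ported verbatim from the HodgeCMPerL package; no docstring in the source.) -/
lemma eq_topI (S : Set.powersetCard (PP K Φ).Idx (k+1+1+1+1)) : S = topI K Φ k hk := by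
  apply Subtype.ext
  have hS : S.val.card = k+1+1+1+1 := S.2
  exact Finset.eq_univ_of_card S.val (by rw [hS, card_Idx_eq K Φ k hk])

/-- the complex volume form: the coordinate along the top eigen-monomial -/
def vol : ⋀[ℂ]^(k+1+1+1+1) (PP K Φ).LC →ₗ[ℂ] ℂ :=
  ((PP K Φ).eB.exteriorPower (k+1+1+1+1)).coord (topI K Φ k hk)

/-- (Ported verbatim from the HodgeCMPerL package; no docstring in the source.) -/
lemma eq_vol_smul (w : ⋀[ℂ]^(k+1+1+1+1) (PP K Φ).LC) :
    w = vol K Φ k hk w • ((PP K Φ).eB.exteriorPower (k+1+1+1+1)) (topI K Φ k hk) := by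
  have h := ((PP K Φ).eB.exteriorPower (k+1+1+1+1)).sum_repr w
  rw [Finset.sum_eq_single (topI K Φ k hk) (fun S _ hS => absurd (eq_topI K Φ k hk S) hS)
    (fun h' => absurd (Finset.mem_univ _) h')] at h
  exact h.symm

/-- the normalising constant `c = vol(Θ(1 ⊗ ω))` -/
def cst : ℂ := vol K Φ k hk ((PP K Φ).Θ (k+1+1+1+1) ((1 : ℂ) ⊗ₜ[ℚ] topB K Φ k hk 0))

/-- (Ported verbatim from the HodgeCMPerL package; no docstring in the source.) -/
lemma cst_ne_zero : cst K Φ k hk ≠ 0 := by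
  intro h0
  have h1 := eq_vol_smul K Φ k hk ((PP K Φ).Θ (k+1+1+1+1) ((1 : ℂ) ⊗ₜ[ℚ] topB K Φ k hk 0))
  rw [show vol K Φ k hk ((PP K Φ).Θ (k+1+1+1+1) ((1 : ℂ) ⊗ₜ[ℚ] topB K Φ k hk 0))
      = cst K Φ k hk from rfl, h0, zero_smul, LinearEquiv.map_eq_zero_iff] at h1
  exact (topB K Φ k hk).ne_zero 0 (ofRat_injective (V := ⋀[ℚ]^(k+1+1+1+1) (PP K Φ).L)
    (h1.trans (TensorProduct.tmul_zero _ (1 : ℂ)).symm))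

/-- `λ` versus `vol`: `λ(x) = c⁻¹ · vol(Θ(1 ⊗ x))` -/
lemma lam_eq (x : ⋀[ℚ]^(k+1+1+1+1) (PP K Φ).L) :
    ((lam K Φ k hk x : ℚ) : ℂ)
      = (cst K Φ k hk)⁻¹ * vol K Φ k hk ((PP K Φ).Θ (k+1+1+1+1) ((1 : ℂ) ⊗ₜ[ℚ] x)) := by
  have h1 : (PP K Φ).Θ (k+1+1+1+1) ((1 : ℂ) ⊗ₜ[ℚ] x)
      = ((lam K Φ k hk x : ℚ) : ℂ) • (PP K Φ).Θ (k+1+1+1+1) ((1 : ℂ) ⊗ₜ[ℚ] topB K Φ k hk 0) := by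
    conv_lhs => rw [eq_lam_smul K Φ k hk x]
    rw [TensorProduct.tmul_smul, ← algebraMap_smul ℂ (lam K Φ k hk x), map_smul]
    rfl
  rw [h1, map_smul, smul_eq_mul, show vol K Φ k hk ((PP K Φ).Θ (k+1+1+1+1)
    ((1 : ℂ) ⊗ₜ[ℚ] topB K Φ k hk 0)) = cst K Φ k hk from rfl,
    mul_comm ((cst K Φ k hk)⁻¹), mul_assoc, mul_inv_cancel₀ (cst_ne_zero K Φ k hk), mul_one]

/-- **Complexification of `D`**: `Θ(1 ⊗ D y) = c⁻¹ · T4_{b,b'}(Θ(1 ⊗ y))`. -/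
theorem theta_DQ (y : ⋀[ℚ]^k (PP K Φ).L) :
    (PP K Φ).Θ (1+1+1+1) ((1 : ℂ) ⊗ₜ[ℚ] DQ K Φ k hk y)
      = (cst K Φ k hk)⁻¹ • T4 (vol K Φ k hk) (bC K Φ) (bC' K Φ) ((PP K Φ).Θ k ((1 : ℂ) ⊗ₜ[ℚ] y)) := by
  have step : ∀ (a b c d : RIdx (PP K Φ)),
      (PP K Φ).Θ (1+1+1+1) ((1 : ℂ) ⊗ₜ[ℚ] (lam K Φ k hk (W4 y (bv K Φ a) (bv K Φ b) (bv K Φ c) (bv K Φ d))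
        • W4' (bv' K Φ a) (bv' K Φ b) (bv' K Φ c) (bv' K Φ d)))
      = (cst K Φ k hk)⁻¹ • (vol K Φ k hk (W4 ((PP K Φ).Θ k ((1 : ℂ) ⊗ₜ[ℚ] y)) (bC K Φ a) (bC K Φ b) (bC K Φ c) (bC K Φ d))
        • W4' (bC' K Φ a) (bC' K Φ b) (bC' K Φ c) (bC' K Φ d)) := by
    intro a b c d
    rw [TensorProduct.tmul_smul, ← algebraMap_smul ℂ (lam K Φ k hk _), map_smul, theta_W4',
      smul_smul]
    congr 1
    rw [show (algebraMap ℚ ℂ) (lam K Φ k hk (W4 y (bv K Φ a) (bv K Φ b) (bv K Φ c) (bv K Φ d)))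
        = ((lam K Φ k hk (W4 y (bv K Φ a) (bv K Φ b) (bv K Φ c) (bv K Φ d)) : ℚ) : ℂ) from rfl,
      lam_eq, theta_W4]
    rfl
  unfold DQ
  rw [T4L_apply]
  unfold T4
  simp only [TensorProduct.tmul_sum, map_sum, Finset.smul_sum, step]

end Star


/-! ## Part S6: eigen-monomial calculus for the four-fold sums -/

section Mono

variable (X : Obj)

/-- (Ported verbatim from the HodgeCMPerL package; no docstring in the source.) -/
lemma ι1_eB (s : X.Idx) : ι1 ℂ X.LC (X.eB s) = X.mono 1 (fun _ => s) := by
  show (oneEquiv ℂ X.LC).symm (X.eB s) = ιMulti ℂ 1 (fun _ => X.eB s)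
  simp [oneEquiv_symm_apply]

variable {X} in
/-- `h` extended by four indices -/
def ext4 {k : ℕ} (h : Fin k → X.Idx) (a b c d : X.Idx) : Fin (k+1+1+1+1) → X.Idx :=
  Fin.append (Fin.append (Fin.append (Fin.append h (fun _ : Fin 1 => a)) (fun _ : Fin 1 => b))
    (fun _ : Fin 1 => c)) (fun _ : Fin 1 => d)

variable {X} in
/-- four indices -/
def q4 (a b c d : X.Idx) : Fin (1+1+1+1) → X.Idx :=
  Fin.append (Fin.append (Fin.append (fun _ : Fin 1 => a) (fun _ : Fin 1 => b)) (fun _ : Fin 1 => c))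
    (fun _ : Fin 1 => d)

/-- (Ported verbatim from the HodgeCMPerL package; no docstring in the source.) -/
lemma W4_mono {k : ℕ} (h : Fin k → X.Idx) (a b c d : X.Idx) :
    W4 (X.mono k h) (X.eB a) (X.eB b) (X.eB c) (X.eB d) = X.mono (k+1+1+1+1) (ext4 h a b c d) := by
  apply Subtype.ext
  simp only [wedge_coe, ι1_eB, Obj.coe_mono_mul, ext4]

/-- (Ported verbatim from the HodgeCMPerL package; no docstring in the source.) -/
lemma W4'_mono (a b c d : X.Idx) :
    W4' (X.eB a) (X.eB b) (X.eB c) (X.eB d) = X.mono (1+1+1+1) (q4 a b c d) := by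
  apply Subtype.ext
  simp only [wedge_coe, ι1_eB, Obj.coe_mono_mul, q4]

/-- half of the eigen-indices are holomorphic -/
lemma two_mul_nhol_univ : 2 * X.nhol Finset.univ = Fintype.card X.Idx := by
  classical
  have h0 : X.nhol Finset.univ = (Finset.univ.filter X.hol).card := by
    unfold Obj.nhol
    congr 1
  have h1 : (Finset.univ.filter fun s => ¬ X.hol s) = (Finset.univ.filter X.hol).image X.bar := by
    ext s
    simp only [Finset.mem_filter, Finset.mem_univ, true_and, Finset.mem_image]
    constructor
    · intro hs
      exact ⟨X.bar s, by rwa [Obj.hol_bar_iff], X.bar_bar s⟩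
    · rintro ⟨t, ht, rfl⟩
      rwa [Obj.hol_bar_iff, not_not]
  have h2 : ((Finset.univ.filter X.hol).image X.bar).card = (Finset.univ.filter X.hol).card :=
    Finset.card_image_of_injective _ (fun s t hst => by
      rw [← X.bar_bar s, ← X.bar_bar t]; exact congrArg X.bar hst)
  have h3 := Finset.card_filter_add_card_filter_not (s := (Finset.univ : Finset X.Idx)) X.hol
  rw [h1, h2, Finset.card_univ] at h3
  omega

variable {X} in
/-- (Ported verbatim from the HodgeCMPerL package; no docstring in the source.) -/
lemma cnt_eq_nhol_univ {n : ℕ} (u : Fin n → X.Idx) (hu : Function.Injective u)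
    (hn : Fintype.card X.Idx = n) : X.cnt u = X.nhol Finset.univ := by
  have him : Finset.univ.image u = Finset.univ :=
    Finset.eq_univ_of_card _ (by rw [Finset.card_image_of_injective _ hu, Finset.card_univ,
      Fintype.card_fin, hn])
  rw [← X.nhol_image u hu, him]

/-- (Ported verbatim from the HodgeCMPerL package; no docstring in the source.) -/
lemma cnt_one_le (s : X.Idx) : X.cnt (fun _ : Fin 1 => s) ≤ 1 := X.cnt_le _

/-- (Ported verbatim from the HodgeCMPerL package; no docstring in the source.) -/
lemma cnt_one_bar (s : X.Idx) : X.cnt (fun _ : Fin 1 => X.bar s) + X.cnt (fun _ : Fin 1 => s) = 1 :=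
  X.cnt_bar (fun _ : Fin 1 => s)

end Mono

/-! ## Part S7: the eigen-sum formula, Hodge types -/

section Esum

variable (K : CMField) (Φ : Fin 4 → CMType K) (k : ℕ)
  (hk : Module.finrank ℚ (PP K Φ).L = k+1+1+1+1)

include hk

/-- **`Θ(1 ⊗ D y) = c⁻¹ · T4_{e,ē}(Θ(1 ⊗ y))`** (Casimir swap). -/
theorem theta_DQ_e (y : ⋀[ℚ]^k (PP K Φ).L) :
    (PP K Φ).Θ (1+1+1+1) ((1 : ℂ) ⊗ₜ[ℚ] DQ K Φ k hk y)
      = (cst K Φ k hk)⁻¹ • T4 (vol K Φ k hk) (PP K Φ).eB (fun s => (PP K Φ).eB ((PP K Φ).bar s))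
          ((PP K Φ).Θ k ((1 : ℂ) ⊗ₜ[ℚ] y)) := by
  rw [theta_DQ]
  exact congrArg ((cst K Φ k hk)⁻¹ • ·) (T4_eq_of_casimir (u := bC K Φ) (u' := bC' K Φ)
    (vol K Φ k hk) (P_casimir K Φ) _)

/-- (Ported verbatim from the HodgeCMPerL package; no docstring in the source.) -/
lemma vol_mono_of_not_injective (u : Fin (k+1+1+1+1) → (PP K Φ).Idx) (hu : ¬ Function.Injective u) :
    vol K Φ k hk ((PP K Φ).mono (k+1+1+1+1) u) = 0 := by
  rw [Obj.mono_eq_zero_of_not_injective _ hu, map_zero]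


-- port_pkg: scope closed for this part
end Esum
end HodgeCM.Toy
end
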